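import Literature.NumberTheory.EllipticCurves.PadicLogEulerOperatorProofs
import Literature.NumberTheory.EllipticCurves.FormalGroupChartLimitLogSurjectiveProofs
import HarnessLib

/-!
# `p²𝒪_w ⊆ log_ω E₁(L_w)`, the Hensel lift of the parameter, and the reduction homomorphism
# `E(L_w) ↠ Ẽ(k_w)` for `W ⊗ L_w` (inputs of the index half of the lattice lemma)

`Proofs` file (theorems only) in topic `NumberTheory/EllipticCurves`, namespace
`Literature.NumberTheory.EllipticCurves.EulerLattice`; sequel of `PadicLogEulerOperatorProofs` (cell
`bsd-addord`, seat w2-acc3 gen 7, route W2, support item 20397; PART D of the E-side lattice lemma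
`log_ω E(K) = E_p(φ)⁻¹𝒪_K`, first instalment).  Setting as there: `W/ℚ` globally minimal, `L : Type` a
number field, `w` a finite place with `p ∈ w`, `K = L_w`, norm valuation `‖·‖₊`, curve `W ⊗ L_w`
(integral: `isIntegral_baseChange`).

* `exists_mem_kernel_zCoord_eq` — **Hensel lift**: every `a` with `‖a‖ < 1` is the parameter `z(P)` of
  a point `P ∈ E₁(L_w)` (the tree's `LocalPoints.exists_mem_kernel_zCoord_eq` for the model
  `W_ℤ ⊗ 𝒪_w`, transported along `W ⊗ L_w = (W_ℤ ⊗ 𝒪_w) ⊗ L_w`);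
* `exists_padicLog_eq_of_norm_le_sq` — **`p²𝒪_w ⊆ log_ω E₁(L_w)`**: every `y` with `‖y‖ ≤ ‖p‖²` is
  `log_ω Q` for some `Q ∈ E₁(L_w)` with `‖z(Q)‖ ≤ ‖p‖²` (successive approximation, the tree's
  `FormalGroupChart.exists_limitLog_eq_of_val_le`, completeness `LocalPoints.exists_limit_of_geometric`);
* `exists_reductionHom` — for `p ∤ Δ_min(W)`: a homomorphism `E(L_w) →+ Ẽ(k_w)` onto the
  `k_w`-points of `(W_ℤ ⊗ 𝒪_w) mod 𝔪_w`, with kernel `E₁(L_w)` (the tree's `goodReductionHom`,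
  `exists_reducePoint_eq` over the henselian `𝒪_w`); `finite_point_reduction_model` — `Ẽ(k_w)` is finite
  (its order is `p^f + 1 − D_f(a_p; p)`, `EulerLatticeReductionCountProofs`).

With `FormalGroupDivision` (`kernelLevel`, `eq_zero_of_nsmul_eq_zero`, `relIndex_kernelLevel_eq`),
`norm_frobeniusCombination_padicLog_le` (⊆) and the Euler-lattice index
(`Theorems/KimAtThreeEulerLatticeIndex`), these are the inputs of the count
`[{y : (φ² − a_pφ + p)y ∈ p𝒪_w} : log_ω E(L_w)] = #E(L_w)[p^∞]`.  Nothing here proves BSD.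

## References

* [SilvermanAEC2009] J. H. Silverman, *The Arithmetic of Elliptic Curves*, 2nd ed. (2009):
  Prop. VII.2.1 (reduction onto `Ẽ(k)`, kernel `E₁`), Prop. VII.2.2, Thm. IV.6.4(b), V.§1.
-/
noncomputable section

open scoped Classical NNReal NumberField

namespace Literature.NumberTheory.EllipticCurves.EulerLattice

open NumberField IsDedekindDomain _root_.WeierstrassCurve Literature.NumberTheory.EllipticCurves
  Literature.NumberTheory.EllipticCurves.FormalGroupChart

variable {L : Type} [Field L] [NumberField L] (w : HeightOneSpectrum (𝓞 L))
  (W : WeierstrassCurve ℚ) [W.IsElliptic] [W.IsGloballyMinimal] {p : ℕ} [hp : Fact p.Prime]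

/-- **Hensel lift of the parameter on `W ⊗ L_w`**: every `a` with `‖a‖ < 1` is `z(P)` for some
`P ∈ E₁(L_w)` (the tree's `LocalPoints.exists_mem_kernel_zCoord_eq` for the model `W_ℤ ⊗ 𝒪_w`,
transported along `W ⊗ L_w = (W_ℤ ⊗ 𝒪_w) ⊗ L_w`). [cite: SilvermanAEC2009, Prop. VII.2.2] -/
theorem exists_mem_kernel_zCoord_eq {a : w.adicCompletion L}
    (ha : (NormedField.valuation : Valuation (w.adicCompletion L) ℝ≥0) a < 1) :
    haveI := isIntegral_baseChange w W
    ∃ P ∈ kernel (NormedField.valuation : Valuation (w.adicCompletion L) ℝ≥0)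
      (W.baseChange (w.adicCompletion L)), P.zCoord = a := by
  haveI hint := isIntegral_baseChange w W
  set W₀ : WeierstrassCurve (w.adicCompletionIntegers L) :=
    (integralModelInt W).map (Int.castRingHom (w.adicCompletionIntegers L)) with hW₀
  have hX : W.baseChange (w.adicCompletion L) = W₀.baseChange (w.adicCompletion L) :=
    baseChange_eq_model_baseChange w W
  haveI hE : (W₀.baseChange (w.adicCompletion L)).IsElliptic := by
    rw [← hX]; infer_instance
  haveI hint₀ := LocalPoints.isIntegral_baseChange w W₀
  obtain ⟨P₀, hP₀, hz⟩ := LocalPoints.exists_mem_kernel_zCoord_eq w W₀ ha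
  refine ⟨Affine.Point.congrEquiv hX.symm P₀, ?_, ?_⟩
  · rcases P₀ with _ | ⟨x, y, h⟩
    · rw [← Affine.Point.zero_def, map_zero]
      exact @AddSubgroup.zero_mem _ _ (kernel (NormedField.valuation : Valuation (w.adicCompletion L) ℝ≥0)
        (W.baseChange (w.adicCompletion L)))
    · rw [Affine.Point.congrEquiv_some]
      have hx := (some_mem_kernel_iff (w := (NormedField.valuation : Valuation (w.adicCompletion L) ℝ≥0)) h).mp hP₀
      show (Affine.Point.some x y (hX.symm ▸ h) : (W.baseChange (w.adicCompletion L)).toAffine.Point) ∈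
        kernel (NormedField.valuation : Valuation (w.adicCompletion L) ℝ≥0) (W.baseChange (w.adicCompletion L))
      exact (some_mem_kernel_iff (w := (NormedField.valuation : Valuation (w.adicCompletion L) ℝ≥0)) _).mpr hx
  · rcases P₀ with _ | ⟨x, y, h⟩
    · rw [← Affine.Point.zero_def, map_zero, WeierstrassCurve.Affine.Point.zCoord_zero]
      rw [← Affine.Point.zero_def, WeierstrassCurve.Affine.Point.zCoord_zero] at hz
      exact hz
    · rw [Affine.Point.congrEquiv_some, WeierstrassCurve.Affine.Point.zCoord_some]
      rw [WeierstrassCurve.Affine.Point.zCoord_some] at hz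
      exact hz

/-- **`p²𝒪_w ⊆ log_ω E₁(L_w)`**: every `y ∈ L_w` with `‖y‖ ≤ ‖p‖²` is `log_ω Q` for a point `Q` of the
kernel of reduction with `‖z(Q)‖ ≤ ‖p‖²` (successive approximation, the tree's
`FormalGroupChart.exists_limitLog_eq_of_val_le`, with the Hensel lift `exists_mem_kernel_zCoord_eq`
and the completeness of `L_w`).  [cite: SilvermanAEC2009, Thm. IV.6.4(b)] -/
theorem exists_padicLog_eq_of_norm_le_sq (hw : ((p : ℕ) : 𝓞 L) ∈ w.asIdeal) {y : w.adicCompletion L}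
    (hy : ‖y‖ ≤ ‖(p : w.adicCompletion L)‖ ^ 2) :
    haveI := isIntegral_baseChange w W
    ∃ Q ∈ kernel (NormedField.valuation : Valuation (w.adicCompletion L) ℝ≥0)
        (W.baseChange (w.adicCompletion L)),
      ‖Q.zCoord‖ ≤ ‖(p : w.adicCompletion L)‖ ^ 2 ∧
      padicLogPointFiniteExt (NormedField.valuation : Valuation (w.adicCompletion L) ℝ≥0)
        (W.baseChange (w.adicCompletion L)) p Q = y := by
  haveI hint := isIntegral_baseChange w W
  have hp1 : (NormedField.valuation : Valuation (w.adicCompletion L) ℝ≥0) (p : w.adicCompletion L) < 1 :=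
    LocalPoints.valuation_natCast_lt_one w hw
  have hp0 : (p : w.adicCompletion L) ≠ 0 := by
    rw [← map_natCast (algebraMap L (w.adicCompletion L)) p]
    exact (map_ne_zero _).mpr (Nat.cast_ne_zero.mpr hp.out.ne_zero)
  have hℓ := limitLog_spec_baseChange w W hw
  have hρ : (NormedField.valuation : Valuation (w.adicCompletion L) ℝ≥0) (p : w.adicCompletion L) ^ 2 < 1 :=
    pow_lt_one₀ zero_le hp1 two_ne_zero
  have hy' : (NormedField.valuation : Valuation (w.adicCompletion L) ℝ≥0) y ≤
      (NormedField.valuation : Valuation (w.adicCompletion L) ℝ≥0) (p : w.adicCompletion L) ^ 2 := by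
    rw [LocalPoints.valuation_apply, LocalPoints.valuation_apply, ← NNReal.coe_le_coe, coe_nnnorm,
      NNReal.coe_pow, coe_nnnorm]
    exact hy
  obtain ⟨Q, hQK, hQz, hQy⟩ := exists_limitLog_eq_of_val_le (V := W.baseChange (w.adicCompletion L))
    hp0 hp1 hℓ le_rfl (fun a ha => exists_mem_kernel_zCoord_eq w W (ha.trans_lt hρ))
    (fun x C θ hθ hx => LocalPoints.exists_limit_of_geometric w x C θ hθ hx) hy'
  refine ⟨Q, hQK, ?_, ?_⟩
  · rw [LocalPoints.valuation_apply, LocalPoints.valuation_apply, ← NNReal.coe_le_coe, coe_nnnorm,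
      NNReal.coe_pow, coe_nnnorm] at hQz
    exact hQz
  · have hQlev : Q ∈ level (NormedField.valuation : Valuation (w.adicCompletion L) ℝ≥0)
        (W.baseChange (w.adicCompletion L))
        ((NormedField.valuation : Valuation (w.adicCompletion L) ℝ≥0) (p : w.adicCompletion L)) :=
      ⟨hQK, hQz.trans (by rw [pow_two]; exact mul_le_of_le_one_left' hp1.le)⟩
    rw [padicLogPointFiniteExt_eq_limitLog hp0 hp1 hℓ hQlev]
    exact hQy

omit [W.IsElliptic] in
/-- **The reduction homomorphism `E(L_w) ↠ Ẽ(k_w)` with kernel `E₁(L_w)`** for `W ⊗ L_w` at a place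
`w ∣ p` of good reduction (`p ∤ Δ_min`): onto (Hensel, `𝒪_w` is henselian; the tree's
`WeierstrassCurve.exists_reducePoint_eq`) with kernel the kernel of reduction `FormalGroupChart.kernel`
(the tree's `goodReductionHom` of the model `W_ℤ ⊗ 𝒪_w`, read on `W ⊗ L_w`).  Its target
`Ẽ(k_w) = (W_ℤ ⊗ 𝒪_w mod 𝔪_w)(k_w)` is finite with `#Ẽ(k_w) = p^f + 1 − D_f(a_p; p)`
(`EulerLatticeReductionCountProofs`). [cite: SilvermanAEC2009, Prop. VII.2.1] -/
theorem exists_reductionHom (hw : ((p : ℕ) : 𝓞 L) ∈ w.asIdeal) (hΔ : ¬ (p : ℤ) ∣ minimalDiscriminantInt W) :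
    haveI := isIntegral_baseChange w W
    ∃ red : (W.baseChange (w.adicCompletion L)).toAffine.Point →+
        (((integralModelInt W).map (Int.castRingHom (w.adicCompletionIntegers L))).map
          (IsLocalRing.residue (w.adicCompletionIntegers L))).toAffine.Point,
      Function.Surjective red ∧
        ∀ P, red P = 0 ↔ P ∈ kernel (NormedField.valuation : Valuation (w.adicCompletion L) ℝ≥0)
          (W.baseChange (w.adicCompletion L)) := by
  classical
  haveI hint := isIntegral_baseChange w W
  have hv := integers_norm w
  set W₀ : WeierstrassCurve (w.adicCompletionIntegers L) :=
    (integralModelInt W).map (Int.castRingHom (w.adicCompletionIntegers L)) with hW₀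
  have hX : W.baseChange (w.adicCompletion L) = W₀.baseChange (w.adicCompletion L) :=
    baseChange_eq_model_baseChange w W
  have hΔ₀ : IsUnit W₀.Δ := isUnit_Δ_model w W hw hΔ
  refine ⟨(goodReductionHom W₀ hv hΔ₀).comp (Affine.Point.congrEquiv hX).toAddMonoidHom, ?_, ?_⟩
  · intro Q
    obtain ⟨P, -, hP⟩ := W₀.exists_reducePoint_eq (K := w.adicCompletion L) hv.hom_inj Q
    refine ⟨(Affine.Point.congrEquiv hX).symm P, ?_⟩
    change WeierstrassCurve.reducePoint W₀ (Affine.Point.congrEquiv hX ((Affine.Point.congrEquiv hX).symm P)) = Q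
    rw [AddEquiv.apply_symm_apply, hP]
  · intro P
    change goodReductionHom W₀ hv hΔ₀ (Affine.Point.congrEquiv hX P) = 0 ↔ _
    rw [goodReductionHom_eq_zero_iff]
    rcases P with _ | ⟨x, y, h⟩
    · rw [← Affine.Point.zero_def, map_zero]
      exact ⟨fun _ => @AddSubgroup.zero_mem _ _ (kernel (NormedField.valuation : Valuation (w.adicCompletion L) ℝ≥0)
        (W.baseChange (w.adicCompletion L))), fun _ => WeierstrassCurve.reducesToZero_zero⟩
    · rw [Affine.Point.congrEquiv_some, WeierstrassCurve.reducesToZero_some_iff, not_mem_range_iff hv]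
      exact (some_mem_kernel_iff (w := (NormedField.valuation : Valuation (w.adicCompletion L) ℝ≥0)) h).symm

omit [W.IsElliptic] in
/-- `Ẽ(k_w)` is finite (Silverman V.§1). [cite: SilvermanAEC2009, V.§1] -/
theorem finite_point_reduction_model :
    Finite (((integralModelInt W).map (Int.castRingHom (w.adicCompletionIntegers L))).map
      (IsLocalRing.residue (w.adicCompletionIntegers L))).toAffine.Point :=
  WeierstrassCurve.finite_point _

end Literature.NumberTheory.EllipticCurves.EulerLattice
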